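import Summits.Ventures.CertifiedArithmetic.Expansions.Orient2dEstimate
import Literature.ComputerArithmetic.Shewchuk1997.FastExpansionSum
import Literature.ComputerArithmetic.BoldoJeannerodMelquiondMuller2023.ExactAddition
import Mathlib.Tactic.Linarith
import Mathlib.Tactic.Positivity
import Mathlib.Tactic.Ring
import Mathlib.Tactic.NormNum

/-!
# The fixed-precision error constant of APPROXIMATE under round-to-even

NEW WORK, HONEST FRAMING: a modest, fully checked constant (Shewchuk 1997 §2.7 only quotes the
relative error `ε·|Σ|` of APPROXIMATE = `estimate()` of `predicates.c`: add the components,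
smallest first, one rounding each); no open problem.  RESULT.  For a round-to-nearest `fl` on
`F(p, emin)`, `p ≥ 1`, whose roundoff is 2-below its result (`RoundoffBelow 2`: round-to-even
qualifies; with arbitrary tie-breaking the supremum is `3/4·u·2^s`, files `EstimateThreeQuarters*`)
every nonoverlapping expansion with components `< 2^s` has `|estimate l − Σ l| < S(p)·u·2^s`
(`u = 2^-p`; stated as `S(p)·2^(s−p)`), `S(p) = (3·2^p − 2)/(2^(p+2) − 2) = 3/4 − 1/(2^(p+3) − 4)`
(`5/7, 11/15, 95/127` for `p = 2, 3, 6`), and the running word is `Q = M·2^v`, `|M| < 2^p`, with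
`|Q − Σ| < τ(p)·2^v`,
`τ(p) = (2^p − 1)/(2^(p+1) − 1)` (`estimate_sharp_invariant`; `S = (1 + τ)/2`).  The companion
file `EstimateFixedPrecisionChain` attains `S(p)·u·2^s·(1 − 2^-n)` for every `n` (`p ≥ 2`), so
`S(p)·u·2^s` IS the supremum.  MECHANISM: joint induction of the τ-bound at the last bit of `Q`
and the `S`-bound at the scale of the components; every rounding is absorbed by the free room
`2^v` below the new last bit except the exact tie, where 2-belowness puts `fl` on the grid
`2^(g+1)` and doubles the room.
-/

namespace Summit.Ventures.CertifiedArithmetic.Expansions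

open Literature.ComputerArithmetic.JeannerodRump2018
open Literature.ComputerArithmetic.BoldoJeannerodMelquiondMuller2023 hiding twoSum twoSum_fst
  isFloat_twoSum
open Literature.ComputerArithmetic.JoldesMullerPopescu2017 (isFloat_two_zpow)
open Literature.ComputerArithmetic.Shewchuk1997

variable {p : ℕ} {emin : ℤ} {fl : ℚ → ℚ}

/-- `2 ≤ 2^p` for `p ≥ 1`. -/
private theorem two_le_P (hp : 1 ≤ p) : (2 : ℚ) ≤ (2 : ℚ) ^ p :=
  le_self_pow₀ (by norm_num) (by omega)

/-- Transport of the sharp last-bit bound to a float lying on a grid `2^w` at which it holds: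
the float then has a presentation `M·2^v`, `|M| < 2^p`, with the bound at `2^v`. -/
private theorem sharpRep_of_onGrid {T E : ℚ} (hT : IsFloat p emin T) {w : ℤ} (hw : emin ≤ w)
    (hg : OnGrid w T) (hE : (2 * (2 : ℚ) ^ p - 1) * |E| < ((2 : ℚ) ^ p - 1) * (2 : ℚ) ^ w) :
    ∃ M v : ℤ, |M| < 2 ^ p ∧ emin ≤ v ∧ T = (M : ℚ) * (2 : ℚ) ^ v ∧
      (2 * (2 : ℚ) ^ p - 1) * |E| < ((2 : ℚ) ^ p - 1) * (2 : ℚ) ^ v := by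
  obtain ⟨M, e, hM, he, hTe⟩ := hT
  rcases le_or_gt w e with hwe | hew
  · refine ⟨M, e, hM, he, hTe, hE.trans_le (mul_le_mul_of_nonneg_left
      (zpow_le_zpow_right₀ (by norm_num) hwe) ?_)⟩
    linarith [one_le_pow₀ (M₀ := ℚ) (a := 2) (n := p) (by norm_num)]
  · obtain ⟨N, hN⟩ := hg
    refine ⟨N, w, lt_of_le_of_lt ?_ hM, hw, hN, hE⟩
    obtain ⟨d, hd⟩ := Int.eq_ofNat_of_zero_le (show 0 ≤ w - e by omega)
    have h2e : (0 : ℚ) < (2 : ℚ) ^ e := zpow_pos (by norm_num) _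
    have hMN : (M : ℚ) = N * 2 ^ d := by
      refine mul_right_cancel₀ h2e.ne' ?_
      rw [← hTe, hN, show w = e + (d : ℤ) by omega, zpow_add₀ (by norm_num : (2 : ℚ) ≠ 0),
        zpow_natCast]; ring
    rw [show M = N * 2 ^ d by exact_mod_cast hMN, abs_mul, abs_pow, abs_two]
    exact le_mul_of_one_le_right (abs_nonneg _) (one_le_pow₀ (by norm_num))

/-- A point of the grid `2^w` (`w ≥ emin`) of magnitude at most `2^(w+p)` is a float. -/
private theorem isFloat_of_onGrid_le (hp : 1 ≤ p) {w : ℤ} (hw : emin ≤ w) {T : ℚ}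
    (hg : OnGrid w T) (hT : |T| ≤ (2 : ℚ) ^ (w + p)) : IsFloat p emin T := by
  obtain ⟨N, rfl⟩ := hg
  have h2w : (0 : ℚ) < (2 : ℚ) ^ w := zpow_pos (by norm_num) _
  rw [abs_mul, abs_of_pos h2w, zpow_add₀ (by norm_num : (2 : ℚ) ≠ 0), zpow_natCast,
    mul_comm ((2 : ℚ) ^ w)] at hT
  exact isFloat_of_abs_le hp (by exact_mod_cast le_of_mul_le_mul_right hT h2w) hw

/-- If `|t| ≥ 2^(g+p-1)` (`g ≥ emin`) then `fl t` lies on the grid `2^g`. -/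
private theorem onGrid_fl_of_le_abs (hp : 1 ≤ p) (hfl : IsRoundNearest p emin fl) {g : ℤ}
    (hg : emin ≤ g) {t : ℚ} (ht : (2 : ℚ) ^ (g + p - 1) ≤ |t|) : OnGrid g (fl t) := by
  obtain ⟨M, e, hM, he, hfe⟩ := (hfl t).1
  have hpos : (0 : ℚ) < (2 : ℚ) ^ (g + p - 1) := zpow_pos (by norm_num) _
  have h0 : |(2 : ℚ) ^ (g + p - 1)| ≤ |t| := by rwa [abs_of_pos hpos]
  have h1 := abs_le_abs_fl hfl (isFloat_two_zpow hp (by omega)) h0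
  rw [abs_of_pos hpos] at h1
  have h2e : (0 : ℚ) < (2 : ℚ) ^ e := zpow_pos (by norm_num) _
  have hlt : (2 : ℚ) ^ (g + p - 1) < (2 : ℚ) ^ ((p : ℤ) + e) := by
    rw [zpow_add₀ (by norm_num), zpow_natCast]; refine h1.trans_lt ?_
    rw [hfe, abs_mul, abs_of_pos h2e]; exact mul_lt_mul_of_pos_right (by exact_mod_cast hM) h2e
  have := (zpow_lt_zpow_iff_right₀ (by norm_num : (1 : ℚ) < 2)).mp hlt
  exact (show OnGrid e (fl t) from ⟨M, hfe⟩).mono (by omega)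

/-- **The step.** One rounded addition `Q ↦ fl (Q + x)` of the next component `x = m·2^a`
(`|m| < 2^p`; everything accumulated so far is `< 2^a`) preserves the sharp last-bit
presentation and the scale bound. -/
private theorem sharp_step (hp : 1 ≤ p) (hfl : IsRoundNearest p emin fl)
    (hfl2 : RoundoffBelow 2 fl) {Q S x : ℚ} {m a : ℤ} (hm : |m| < 2 ^ p) (hea : emin ≤ a)
    (hx : x = (m : ℚ) * (2 : ℚ) ^ a) (hx0 : x ≠ 0) (hS : |S| < (2 : ℚ) ^ a)
    (h1 : ∃ M v : ℤ, |M| < 2 ^ p ∧ emin ≤ v ∧ Q = (M : ℚ) * (2 : ℚ) ^ v ∧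
      (2 * (2 : ℚ) ^ p - 1) * |Q - S| < ((2 : ℚ) ^ p - 1) * (2 : ℚ) ^ v)
    (h2 : (4 * (2 : ℚ) ^ p - 2) * |Q - S| < (3 * (2 : ℚ) ^ p - 2) * (2 : ℚ) ^ (a - p)) :
    (∃ M v : ℤ, |M| < 2 ^ p ∧ emin ≤ v ∧ fl (Q + x) = (M : ℚ) * (2 : ℚ) ^ v ∧
      (2 * (2 : ℚ) ^ p - 1) * |fl (Q + x) - (S + x)| < ((2 : ℚ) ^ p - 1) * (2 : ℚ) ^ v) ∧
    ∀ b : ℤ, |x| < (2 : ℚ) ^ b →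
      (4 * (2 : ℚ) ^ p - 2) * |Q - S| < (3 * (2 : ℚ) ^ p - 2) * (2 : ℚ) ^ (b - p) →
        (4 * (2 : ℚ) ^ p - 2) * |fl (Q + x) - (S + x)| <
          (3 * (2 : ℚ) ^ p - 2) * (2 : ℚ) ^ (b - p) := by
  have h2ne : (2 : ℚ) ≠ 0 := by norm_num
  obtain ⟨M, v, hM, hev, hQ, hE⟩ := h1
  set P : ℚ := (2 : ℚ) ^ p with hPdef
  have hP2 : 2 ≤ P := two_le_P hp
  set T := Q + x with hTdef
  set E := Q - S with hEdef
  have hEnew : ∀ R : ℚ, R - (S + x) = (R - T) + E := by intro R; rw [hTdef, hEdef]; ring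
  have hmq : |(m : ℚ)| < P := by rw [hPdef]; exact_mod_cast hm
  have hMq : |(M : ℚ)| < P := by rw [hPdef]; exact_mod_cast hM
  have h2a : (0 : ℚ) < (2 : ℚ) ^ a := zpow_pos (by norm_num) _
  have h2v : (0 : ℚ) < (2 : ℚ) ^ v := zpow_pos (by norm_num) _
  have hxF : IsFloat p emin x := hx ▸ isFloat_of_abs_le hp hm.le hea
  have hxg : OnGrid a x := ⟨m, hx⟩
  have hQg : OnGrid v Q := ⟨M, hQ⟩
  have hax : (2 : ℚ) ^ a ≤ |x| := hxg.two_zpow_le_abs hx0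
  have hap : P * (2 : ℚ) ^ (a - p) = (2 : ℚ) ^ a := by
    rw [hPdef, ← zpow_natCast, ← zpow_add₀ h2ne]; congr 1; ring
  have h2ap : (0 : ℚ) < (2 : ℚ) ^ (a - p) := zpow_pos (by norm_num) _
  have hxap : |x| + (2 : ℚ) ^ a ≤ (2 : ℚ) ^ (a + p) := by
    refine hxg.abs.add_two_zpow_le (OnGrid.two_zpow (by omega)) ?_
    calc |x| = |(m : ℚ)| * (2 : ℚ) ^ a := by rw [hx, abs_mul, abs_of_pos h2a]
      _ < P * (2 : ℚ) ^ a := mul_lt_mul_of_pos_right hmq h2a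
      _ = (2 : ℚ) ^ (a + p) := by rw [hPdef, zpow_add₀ h2ne, zpow_natCast, mul_comm]
  have hTQx : |T| ≤ |Q| + |x| := by rw [hTdef]; exact abs_add_le _ _
  have hexact : ∀ w : ℤ, emin ≤ w → OnGrid w T → (2 * P - 1) * |E| < (P - 1) * (2 : ℚ) ^ w →
      fl T = T →
      (∃ M v : ℤ, |M| < 2 ^ p ∧ emin ≤ v ∧ fl T = (M : ℚ) * (2 : ℚ) ^ v ∧
          (2 * P - 1) * |fl T - (S + x)| < (P - 1) * (2 : ℚ) ^ v) ∧
        ∀ b : ℤ, |x| < (2 : ℚ) ^ b → (4 * P - 2) * |E| < (3 * P - 2) * (2 : ℚ) ^ (b - p) →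
          (4 * P - 2) * |fl T - (S + x)| < (3 * P - 2) * (2 : ℚ) ^ (b - p) := by
    intro w hw hwT hEw hfT
    have hTF : IsFloat p emin T := hfT ▸ (hfl T).1
    rw [hfT, hEnew T, sub_self, zero_add]
    exact ⟨sharpRep_of_onGrid hTF hw hwT hEw, fun b _ h2b => h2b⟩
  by_cases hQ0 : Q = 0
  · have hTx : T = x := by rw [hTdef, hQ0, zero_add]
    refine hexact a hea (hTx ▸ hxg) ?_ (by rw [hTx]; exact fl_eq_self hfl hxF)
    have key : 0 ≤ (2 : ℚ) ^ (a - p) * (P - 2) * (2 * P - 1) :=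
      mul_nonneg (mul_nonneg h2ap.le (by linarith)) (by linarith)
    nlinarith [abs_nonneg E, key, hap, h2]
  have hvQ : (2 : ℚ) ^ v ≤ |Q| := hQg.two_zpow_le_abs hQ0
  have hQlt : |Q| < P * (2 : ℚ) ^ v := by
    rw [hQ, abs_mul, abs_of_pos h2v]; exact mul_lt_mul_of_pos_right hMq h2v
  have hEa : |E| < (2 : ℚ) ^ (a - p) := by nlinarith [abs_nonneg E, h2, h2ap]
  have hSE : |Q| ≤ |S| + |E| := by rw [show Q = S + E by rw [hEdef]; ring]; exact abs_add_le _ _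
  rcases le_or_gt ((2 : ℚ) ^ a) |Q| with hQa | hQa
  · have hva : a - p + 1 ≤ v := by
      have h : (2 : ℚ) ^ a < (2 : ℚ) ^ ((p : ℤ) + v) := by
        rw [zpow_add₀ h2ne, zpow_natCast]; exact hQa.trans_lt hQlt
      have := (zpow_lt_zpow_iff_right₀ (one_lt_two (α := ℚ))).mp h; omega
    have hQeq : |Q| = (2 : ℚ) ^ a := by
      by_contra hne
      have hst := (OnGrid.two_zpow (by omega : a - p + 1 ≤ a)).add_two_zpow_le
        (hQg.mono hva).abs (lt_of_le_of_ne hQa (Ne.symm hne))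
      have : (2 : ℚ) ^ (a - p + 1) = (2 : ℚ) ^ (a - p) * 2 := zpow_add_one₀ h2ne _
      linarith
    have hQga : OnGrid a Q := by
      rcases (abs_eq h2a.le).mp hQeq with h | h
      · exact ⟨1, by rw [h]; simp⟩
      · exact ⟨-1, by rw [h]; simp⟩
    have hTg : OnGrid v T := by
      rw [hTdef]; exact hQg.add (hxg.mono ((zpow_le_zpow_iff_right₀ one_lt_two).mp (hQeq ▸ hvQ)))
    exact hexact v hev hTg hE
      (fl_eq_self hfl (isFloat_of_onGrid_le hp hea (hQga.add hxg) (by linarith)))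
  have hva : v < a := (zpow_lt_zpow_iff_right₀ one_lt_two).mp (hvQ.trans_lt hQa)
  have hTg : OnGrid v T := by rw [hTdef]; exact hQg.add (hxg.mono hva.le)
  have hTlt : |T| < (2 : ℚ) ^ (a + p) := by linarith
  have hT0 : T ≠ 0 := fun h0 => by
    have : |x| = |Q| := by rw [show x = -Q by rw [hTdef] at h0; linarith, abs_neg]
    linarith
  obtain ⟨g, hgT, hTg2⟩ : ∃ g : ℤ, (2 : ℚ) ^ (g + p - 1) ≤ |T| ∧ |T| < (2 : ℚ) ^ (g + p) := by
    refine ⟨Int.log 2 |T| - p + 1, ?_, ?_⟩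
    · rw [show Int.log 2 |T| - p + 1 + p - 1 = Int.log 2 |T| by ring]; exact zpow_log_le_abs hT0
    · rw [show Int.log 2 |T| - p + 1 + p = Int.log 2 |T| + 1 by ring]; exact abs_lt_zpow_log_succ T
  have hga : g ≤ a := by
    have h := (zpow_lt_zpow_iff_right₀ (by norm_num : (1 : ℚ) < 2)).mp (lt_of_le_of_lt hgT hTlt)
    omega
  rcases le_or_gt g v with hgv | hvg
  · have hTF : IsFloat p emin T := isFloat_of_onGrid_le hp hev hTg
      (le_of_lt (lt_of_lt_of_le hTg2 (zpow_le_zpow_right₀ (by norm_num) (by omega))))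
    exact hexact v hev hTg hE (fl_eq_self hfl hTF)
  obtain ⟨d, hd⟩ := Int.eq_ofNat_of_zero_le (show 0 ≤ g - v - 1 by omega)
  have hg1 : (2 : ℚ) ^ (g - 1) = (2 : ℚ) ^ d * (2 : ℚ) ^ v := by
    rw [show g - 1 = v + (d : ℤ) by omega, zpow_add₀ h2ne, zpow_natCast, mul_comm]
  have hgg : (2 : ℚ) ^ g = (2 : ℚ) ^ (g - 1) * 2 := by rw [← zpow_add_one₀ h2ne, sub_add_cancel]
  have heg : emin ≤ g := by omega
  have h2g : (0 : ℚ) < (2 : ℚ) ^ g := zpow_pos (by norm_num) _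
  have h2g1 : (0 : ℚ) < (2 : ℚ) ^ (g - 1) := zpow_pos (by norm_num) _
  obtain ⟨n, hn⟩ := hTg
  set D : ℤ := 2 ^ (d + 1) with hDdef
  have hD2 : D = 2 * 2 ^ d := by rw [hDdef, pow_succ]; ring
  have hD0 : (0 : ℤ) < D := by positivity
  set r : ℤ := n % D with hrdef
  set N : ℤ := n / D with hNdef
  have hnNr : n = N * D + r := by rw [hNdef, hrdef]; linarith [Int.mul_ediv_add_emod n D]
  have hr0 : 0 ≤ r := Int.emod_nonneg _ hD0.ne'
  have hrD : r < D := Int.emod_lt_of_pos _ hD0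
  have hDq : (D : ℚ) * (2 : ℚ) ^ v = (2 : ℚ) ^ g := by rw [hDdef, hgg, hg1]; push_cast; ring
  have hTN : T = (N : ℚ) * (2 : ℚ) ^ g + (r : ℚ) * (2 : ℚ) ^ v := by
    rw [hn, hnNr, ← hDq]; push_cast; ring
  have hrq0 : (0 : ℚ) ≤ (r : ℚ) * (2 : ℚ) ^ v := mul_nonneg (by exact_mod_cast hr0) h2v.le
  have hrq1 : (r : ℚ) * (2 : ℚ) ^ v < (2 : ℚ) ^ g := by
    rw [← hDq]; exact mul_lt_mul_of_pos_right (by exact_mod_cast hrD) h2v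
  have hgp : (2 : ℚ) ^ (g + p) = P * (2 : ℚ) ^ g := by
    rw [hPdef, zpow_add₀ h2ne, zpow_natCast, mul_comm]
  have hTabs := abs_lt.mp (hgp ▸ hTg2)
  have hN1 : (N : ℚ) < P :=
    lt_of_mul_lt_mul_right (show (N : ℚ) * (2 : ℚ) ^ g < P * (2 : ℚ) ^ g by linarith) h2g.le
  have hN2 : -P < (N : ℚ) + 1 :=
    lt_of_mul_lt_mul_right (show (-P) * (2 : ℚ) ^ g < ((N : ℚ) + 1) * (2 : ℚ) ^ g by linarith)
      h2g.le
  have hN1' : N < 2 ^ p := by rw [hPdef] at hN1; exact_mod_cast hN1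
  have hN2' : -(2 : ℤ) ^ p < N + 1 := by rw [hPdef] at hN2; exact_mod_cast hN2
  have hf0 : IsFloat p emin ((N : ℚ) * (2 : ℚ) ^ g) :=
    isFloat_of_abs_le hp (abs_le.mpr ⟨by linarith, by linarith⟩) heg
  have hf1 : IsFloat p emin (((N + 1 : ℤ) : ℚ) * (2 : ℚ) ^ g) :=
    isFloat_of_abs_le hp (abs_le.mpr ⟨by linarith, by linarith⟩) heg
  have hδ0 : |T - fl T| ≤ (r : ℚ) * (2 : ℚ) ^ v := by
    have h := (hfl T).2 _ hf0
    rwa [show T - (N : ℚ) * (2 : ℚ) ^ g = (r : ℚ) * (2 : ℚ) ^ v by rw [hTN]; ring,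
      abs_of_nonneg hrq0] at h
  have hδ1 : |T - fl T| ≤ (2 : ℚ) ^ g - (r : ℚ) * (2 : ℚ) ^ v := by
    have h := (hfl T).2 _ hf1
    rwa [show T - ((N + 1 : ℤ) : ℚ) * (2 : ℚ) ^ g = -((2 : ℚ) ^ g - (r : ℚ) * (2 : ℚ) ^ v) by
      rw [hTN]; push_cast; ring, abs_neg,
      abs_of_nonneg (show (0 : ℚ) ≤ (2 : ℚ) ^ g - (r : ℚ) * (2 : ℚ) ^ v by linarith)] at h
  by_cases hr : r = 0
  · have h : |T - fl T| ≤ 0 := by simpa [hr] using hδ0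
    exact hexact v hev ⟨n, hn⟩ hE (by linarith [abs_nonpos_iff.mp h])
  have hflg : OnGrid g (fl T) := onGrid_fl_of_le_abs hp hfl heg hgT
  have hgb : ∀ b : ℤ, |x| < (2 : ℚ) ^ b → (2 : ℚ) ^ g ≤ (2 : ℚ) ^ (b - p) := fun b hxb => by
    have hab := (zpow_lt_zpow_iff_right₀ (by norm_num : (1 : ℚ) < 2)).mp (hax.trans_lt hxb)
    have h := (zpow_lt_zpow_iff_right₀ (by norm_num : (1 : ℚ) < 2)).mp (lt_of_le_of_lt hgT
      (show |T| < (2 : ℚ) ^ b by linarith [hxg.abs.add_two_zpow_le (OnGrid.two_zpow hab.le) hxb]))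
    exact zpow_le_zpow_right₀ (by norm_num) (by omega)
  have htri : |fl T - (S + x)| ≤ |T - fl T| + |E| := by
    rw [hEnew (fl T), abs_sub_comm T]; exact abs_add_le _ _
  by_cases htie : 2 * r = D
  · have hrv : (r : ℚ) * (2 : ℚ) ^ v = (2 : ℚ) ^ (g - 1) := by
      have h : ((2 * r : ℤ) : ℚ) * (2 : ℚ) ^ v = (2 : ℚ) ^ g := by rw [htie]; exact hDq
      push_cast at h; linarith
    have hTodd : T = ((2 * N + 1 : ℤ) : ℚ) * (2 : ℚ) ^ (g - 1) := by
      rw [hTN, hrv, hgg]; push_cast; ring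
    have hδne : fl T - T ≠ 0 := fun h0 => by
      have h : OnGrid g (((2 * N + 1 : ℤ) : ℚ) * (2 : ℚ) ^ (g - 1)) := by
        rw [← hTodd, show T = fl T by linarith]; exact hflg
      have := OnGrid.le_of_odd (odd_two_mul_add_one N) h
      omega
    have hδlo : (2 : ℚ) ^ (g - 1) ≤ |T - fl T| := by
      rw [abs_sub_comm]
      exact ((hflg.mono (by omega)).sub ⟨2 * N + 1, hTodd⟩).two_zpow_le_abs hδne
    have hδhi : |T - fl T| ≤ (2 : ℚ) ^ (g - 1) := hrv ▸ hδ0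
    obtain ⟨k, hk, hk2⟩ := hfl2 T
    have hflg1 : OnGrid (g + 1) (fl T) := hk.mono (by
      by_contra hlt
      have : (2 : ℚ) ^ k ≤ (2 : ℚ) ^ g := zpow_le_zpow_right₀ (by norm_num) (by omega)
      linarith)
    have hnew : (2 * P - 1) * |fl T - (S + x)| < (3 * P - 2) * (2 : ℚ) ^ (g - 1) := by
      have e1 := mul_le_mul_of_nonneg_left htri (by linarith : (0 : ℚ) ≤ 2 * P - 1)
      have e2 := mul_le_mul_of_nonneg_left hδhi (by linarith : (0 : ℚ) ≤ 2 * P - 1)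
      have e3 := mul_le_mul_of_nonneg_left (zpow_le_zpow_right₀ (by norm_num : (1 : ℚ) ≤ 2)
        (show v ≤ g - 1 by omega)) (by linarith : (0 : ℚ) ≤ P - 1)
      linarith
    refine ⟨sharpRep_of_onGrid (hfl T).1 (by omega) hflg1 ?_, fun b hxb h2b => ?_⟩
    · have e4 : 0 ≤ (P - 2) * (2 : ℚ) ^ (g - 1) := mul_nonneg (by linarith) h2g1.le
      rw [show (2 : ℚ) ^ (g + 1) = (2 : ℚ) ^ (g - 1) * 4 by rw [zpow_add_one₀ h2ne, hgg]; ring]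
      linarith
    · have e5 := mul_le_mul_of_nonneg_left (hgb b hxb) (by linarith : (0 : ℚ) ≤ 3 * P - 2)
      have e6 : (3 * P - 2) * (2 : ℚ) ^ g = 2 * ((3 * P - 2) * (2 : ℚ) ^ (g - 1)) := by
        rw [hgg]; ring
      linarith
  have hδ : |T - fl T| ≤ (2 : ℚ) ^ (g - 1) - (2 : ℚ) ^ v := by
    rcases lt_or_gt_of_ne htie with hlt | hgt
    · have h' : (r : ℚ) ≤ (2 : ℚ) ^ d - 1 := by exact_mod_cast (show r ≤ 2 ^ d - 1 by omega)
      calc |T - fl T| ≤ (r : ℚ) * (2 : ℚ) ^ v := hδ0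
        _ ≤ ((2 : ℚ) ^ d - 1) * (2 : ℚ) ^ v := mul_le_mul_of_nonneg_right h' h2v.le
        _ = (2 : ℚ) ^ (g - 1) - (2 : ℚ) ^ v := by rw [hg1]; ring
    · have h' : ((D : ℚ) - r) ≤ (2 : ℚ) ^ d - 1 := by
        exact_mod_cast (show D - r ≤ 2 ^ d - 1 by omega)
      calc |T - fl T| ≤ (2 : ℚ) ^ g - (r : ℚ) * (2 : ℚ) ^ v := hδ1
        _ = ((D : ℚ) - r) * (2 : ℚ) ^ v := by rw [← hDq]; ring
        _ ≤ ((2 : ℚ) ^ d - 1) * (2 : ℚ) ^ v := mul_le_mul_of_nonneg_right h' h2v.le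
        _ = (2 : ℚ) ^ (g - 1) - (2 : ℚ) ^ v := by rw [hg1]; ring
  rcases le_or_gt d p with hdp | hpd
  · have hPV : (2 : ℚ) ^ (g - 1) ≤ P * (2 : ℚ) ^ v := by
      rw [hg1, hPdef]; exact mul_le_mul_of_nonneg_right (pow_le_pow_right₀ (by norm_num) hdp) h2v.le
    have hnew : (2 * P - 1) * |fl T - (S + x)| < (P - 1) * (2 : ℚ) ^ g := by
      have e1 := mul_le_mul_of_nonneg_left htri (by linarith : (0 : ℚ) ≤ 2 * P - 1)
      have e2 := mul_le_mul_of_nonneg_left hδ (by linarith : (0 : ℚ) ≤ 2 * P - 1)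
      rw [hgg]; linarith
    refine ⟨sharpRep_of_onGrid (hfl T).1 heg hflg hnew, fun b hxb h2b => ?_⟩
    have e5 := mul_le_mul_of_nonneg_left (hgb b hxb) (by linarith : (0 : ℚ) ≤ 3 * P - 2)
    have e6 : 0 ≤ P * (2 : ℚ) ^ g := by positivity
    linarith
  · have hP4 : 4 * (P * (2 : ℚ) ^ v) ≤ (2 : ℚ) ^ g := by
      have h : (2 : ℚ) ^ (p + 1) ≤ (2 : ℚ) ^ d := pow_le_pow_right₀ (by norm_num) hpd
      have h' := mul_le_mul_of_nonneg_right h (show (0 : ℚ) ≤ 2 * (2 : ℚ) ^ v by positivity)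
      rw [hgg, hg1, hPdef]; rw [pow_succ] at h'; linarith
    have hfx : fl T = x := by
      have hnear : |T - fl T| ≤ |Q| := by
        have h := (hfl T).2 x hxF
        rwa [show T - x = Q by rw [hTdef]; ring] at h
      by_contra hne
      have hlo := (hflg.sub (hxg.mono hga)).two_zpow_le_abs (sub_ne_zero.mpr hne)
      have hhi : |fl T - x| ≤ |T - fl T| + |Q| := by
        rw [show fl T - x = -(T - fl T) + Q by rw [hTdef]; ring]
        exact (abs_add_le _ _).trans (by rw [abs_neg])
      linarith
    have hSle : |S| ≤ |Q| + |E| := by rw [show S = Q - E by rw [hEdef]; ring]; exact abs_sub _ _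
    have hnew : (2 * P - 1) * |fl T - (S + x)| < (2 * P ^ 2 - 1) * (2 : ℚ) ^ v := by
      rw [show fl T - (S + x) = -S by rw [hfx]; ring, abs_neg]
      have e1 := mul_le_mul_of_nonneg_left hSle (by linarith : (0 : ℚ) ≤ 2 * P - 1)
      have e2 := mul_le_mul_of_nonneg_left hQlt.le (by linarith : (0 : ℚ) ≤ 2 * P - 1)
      linarith
    have e7 : 0 ≤ (P - 2) * (P * (2 : ℚ) ^ v) := mul_nonneg (by linarith) (by positivity)
    have e9 : 0 ≤ P * (2 : ℚ) ^ v := by positivity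
    refine ⟨?_, fun b hxb h2b => ?_⟩
    · have e3 := mul_le_mul_of_nonneg_left (zpow_le_zpow_right₀ (by norm_num : (1 : ℚ) ≤ 2) hga)
        (by linarith : (0 : ℚ) ≤ P - 1)
      have e4 := mul_le_mul_of_nonneg_left hP4 (by linarith : (0 : ℚ) ≤ P - 1)
      have h := sharpRep_of_onGrid (E := fl T - (S + x)) hxF hea hxg (by linarith)
      rwa [hfx] at h ⊢
    · have e5 := mul_le_mul_of_nonneg_left (hgb b hxb) (by linarith : (0 : ℚ) ≤ 3 * P - 2)
      have e8 := mul_le_mul_of_nonneg_left hP4 (by linarith : (0 : ℚ) ≤ 3 * P - 2)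
      linarith

/-- **The joint invariant of APPROXIMATE.** On a nonoverlapping expansion of floats (`p ≥ 1`,
smallest component first), under a round-to-nearest whose roundoff is 2-below its result, the
running word `Q = estimate fl l` has a presentation `Q = M·2^v`, `|M| < 2^p`, `v ≥ emin`, with
`(2^(p+1) − 1)·|Q − Σ l| < (2^p − 1)·2^v` (SHARP LAST BIT), and for every scale `2^b` bounding
all components `(2^(p+2) − 2)·|Q − Σ l| < (3·2^p − 2)·2^(b−p)` (SCALE BOUND). -/
theorem estimate_sharp_invariant (hp : 1 ≤ p) (hfl : IsRoundNearest p emin fl)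
    (hfl2 : RoundoffBelow 2 fl) :
    ∀ {l : List ℚ}, (∀ x ∈ l, IsFloat p emin x) → IsExpansion 1 l →
      (∃ M v : ℤ, |M| < 2 ^ p ∧ emin ≤ v ∧ estimate fl l = (M : ℚ) * (2 : ℚ) ^ v ∧
          (2 * (2 : ℚ) ^ p - 1) * |estimate fl l - l.sum| < ((2 : ℚ) ^ p - 1) * (2 : ℚ) ^ v) ∧
        ∀ b : ℤ, (∀ x ∈ l, |x| < (2 : ℚ) ^ b) →
          (4 * (2 : ℚ) ^ p - 2) * |estimate fl l - l.sum| <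
            (3 * (2 : ℚ) ^ p - 2) * (2 : ℚ) ^ (b - p) := by
  have hP2 : (2 : ℚ) ≤ (2 : ℚ) ^ p := two_le_P hp
  intro l
  induction l using List.reverseRecOn with
  | nil =>
    intro _ _
    rw [show estimate fl [] = 0 from rfl, List.sum_nil, sub_zero, abs_zero, mul_zero, mul_zero]
    exact ⟨⟨0, emin, by simp, le_rfl, by simp, mul_pos (by linarith) (zpow_pos (by norm_num) _)⟩,
      fun b _ => mul_pos (by linarith) (zpow_pos (by norm_num) _)⟩
  | append_singleton l a ih =>
    intro hF hE
    have hFl : ∀ x ∈ l, IsFloat p emin x := fun x hx => hF x (by simp [hx])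
    have hFa : IsFloat p emin a := hF a (by simp)
    have hEl : IsExpansion 1 l := (List.pairwise_append.mp hE).1
    rw [List.sum_append, List.sum_singleton]
    have hstep : estimate fl (l ++ [a]) = fl (estimate fl l + a) := by
      rcases l with _ | ⟨e, es⟩
      · simpa [estimate] using (fl_eq_self hfl hFa).symm
      · simp [estimate, List.foldl_append]
    rw [hstep]
    obtain ⟨h1, h2⟩ := ih hFl hEl
    by_cases ha0 : a = 0
    · obtain ⟨M, v, hM, hv, hQ, hE1⟩ := h1
      rw [ha0, add_zero, add_zero, fl_eq_self hfl ⟨M, v, hM, hv, hQ⟩]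
      exact ⟨⟨M, v, hM, hv, hQ, hE1⟩, fun b hb => h2 b fun x hx => hb x (by simp [hx])⟩
    obtain ⟨m, α, hmo, hm, hα, haα⟩ := exists_odd_mul_two_zpow hFa ha0
    have hlα : ∀ x ∈ l, |x| < (2 : ℚ) ^ α := fun x hx => by
      obtain ⟨s', hs', hxs'⟩ := (List.pairwise_append.mp hE).2.2 x hx a (by simp)
      rw [one_mul] at hxs'
      rw [haα] at hs'
      exact lt_of_lt_of_le hxs' (zpow_le_zpow_right₀ (by norm_num) (OnGrid.le_of_odd hmo hs'))
    have hst := sharp_step hp hfl hfl2 hm hα haα ha0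
      (abs_sum_lt_two_zpow_of_isExpansion hFl hEl hlα) h1 (h2 α hlα)
    exact ⟨hst.1, fun b hb => hst.2 b (hb a (by simp)) (h2 b fun x hx => hb x (by simp [hx]))⟩

/-- **THE FIXED-PRECISION CONSTANT.** On every nonoverlapping expansion of floats of `F(p, emin)`
(`p ≥ 1`) with components `< 2^s`, under a round-to-nearest whose roundoff is 2-below its result
(round-to-even is one): `|estimate l − Σ l| < S(p)·2^(s−p)`, `S(p) = (3·2^p − 2)/(2^(p+2) − 2)`. -/
theorem abs_estimate_sub_sum_lt_sharp (hp : 1 ≤ p) (hfl : IsRoundNearest p emin fl)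
    (hfl2 : RoundoffBelow 2 fl) {l : List ℚ} (hF : ∀ x ∈ l, IsFloat p emin x)
    (hE : IsExpansion 1 l) {s : ℤ} (hs : ∀ x ∈ l, |x| < (2 : ℚ) ^ s) :
    |estimate fl l - l.sum| < (3 * 2 ^ p - 2) / (2 ^ (p + 2) - 2) * (2 : ℚ) ^ (s - p) := by
  have h := (estimate_sharp_invariant hp hfl hfl2 hF hE).2 s hs
  have := two_le_P hp
  rw [pow_add, div_mul_eq_mul_div, lt_div_iff₀ (by norm_num; linarith)]; norm_num; linarith

/-- **ROUND-TO-EVEN: `|estimate l − Σ l| < S(p)·2^(s−p)`**, `S(p) = (3·2^p − 2)/(2^(p+2) − 2)`,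
on every nonoverlapping expansion of floats of `F(p, emin)` with components `< 2^s` (`p ≥ 1`). -/
theorem abs_estimate_sub_sum_lt_sharp_roundTiesEven (hp : 1 ≤ p) {l : List ℚ}
    (hF : ∀ x ∈ l, IsFloat p emin x) (hE : IsExpansion 1 l) {s : ℤ}
    (hs : ∀ x ∈ l, |x| < (2 : ℚ) ^ s) :
    |estimate (roundTiesEven p emin) l - l.sum| <
      (3 * 2 ^ p - 2) / (2 ^ (p + 2) - 2) * (2 : ℚ) ^ (s - p) :=
  abs_estimate_sub_sum_lt_sharp hp (isRoundNearest_roundTiesEven hp)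
    (roundoffBelow_two_roundTiesEven p emin) hF hE hs

end Summit.Ventures.CertifiedArithmetic.Expansions
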